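import Mathlib
import Summits.ValiantsHypothesis.ValiantsHypothesis.Theorems.NewtonUnitEquationsDissociatedUniformTotalsLawChartTops
import Summits.ValiantsHypothesis.ValiantsHypothesis.Theorems.NewtonUnitEquationsDissociatedUniformTotalsLawChartLevels
import Summits.ValiantsHypothesis.ValiantsHypothesis.Theorems.NewtonUnitEquationsDissociatedUniformTotalsLawChartLevelsTopSets
import Summits.ValiantsHypothesis.ValiantsHypothesis.Theorems.NewtonUnitEquationsDissociatedUniformTotalsLawChartLevelsCount
import HarnessLib

/-!
# Crux `NewtonUnitEquations.DissociatedUniform` (stmt-ValiantsHypothesis-5905): totals law — few letter pairs are ever simultaneously shallow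

Companion of `…TotalsLawChartLevels` / `…ChartLevelsTopSets` / `…ChartLevelsCount`.  Brick (R3) of memo
`Cruxes/DissociatedUniform/NOTES-t1g4.md` §4 in the form the depth bookkeeping consumes: along the chart `t ↦ (σ, t)`, for two
finite planar letter sets `A`, `B` and a depth `k`, the number of PAIRS `(x, y) ∈ A × B` that are simultaneously among the top `k`
of their alphabets at some generic time is at most `k² · (#lowEvents σ A k + #lowEvents σ B k + 1) ≤ k² (16k(|A| + |B|) + 1)` —
linear in the alphabet sizes, polynomial in the depth.  (A fibre piece of fibre-depth `< k` at a generic time has both letters of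
rank `< k`, memo (R2); so pieces of bounded depth are `O(q)`.)

* `Generic σ F t`: no two distinct points of `F` tie at time `t`; `card_topSet_le_of_generic`: then `#topSet σ F k t ≤ k`.
* `topSet_eq_of_cellIdx_eq`: two generic times not separated by a low-event time have the same top-`k` sets
  (`exists_lowEvent_of_topSet_ne`).
* **`card_shallowPairs_le`**, **`card_shallowPairs_le_linear`**: the pair count.
Honest label: tool lemmas only; nothing here bears on VP ≠ VNP.
[folklore: levels in arrangements of lines]
-/

set_option linter.dupNamespace false -- `ValiantsHypothesis.ValiantsHypothesis` (summit = problem) in every name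

open scoped BigOperators

namespace Summit.ValiantsHypothesis.ValiantsHypothesis.Theorems.NewtonUnitEquationsDissociatedUniform

namespace TotalsLaw

open Literature.Computability.AlgebraicComplexity.KPTT.PlanarMinkowski

variable {σ : ℝ}

/-- `t` is a GENERIC time for `F`: no two distinct points of `F` have the same score. -/
def Generic (σ : ℝ) (F : Finset (Fin 2 → ℝ)) (t : ℝ) : Prop :=
  ∀ p ∈ F, ∀ q ∈ F, p ≠ q → ![σ, t] ⬝ᵥ p ≠ ![σ, t] ⬝ᵥ q

/-- At a generic time the rank is injective on `F`. [folklore] -/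
theorem rank_injOn_of_generic {F : Finset (Fin 2 → ℝ)} {t : ℝ} (hgen : Generic σ F t) :
    Set.InjOn (rank σ F t) (F : Set (Fin 2 → ℝ)) := by
  classical
  -- a strictly lower point has strictly larger rank
  have key : ∀ p ∈ F, ∀ q ∈ F, ![σ, t] ⬝ᵥ p < ![σ, t] ⬝ᵥ q → rank σ F t q < rank σ F t p := by
    intro p hp q hq hlt
    unfold rank
    refine Finset.card_lt_card ⟨fun y hy => ?_, fun hsub => ?_⟩
    · obtain ⟨hyF, hylt⟩ := Finset.mem_filter.1 hy
      exact Finset.mem_filter.2 ⟨hyF, hlt.trans hylt⟩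
    · have hq' : q ∈ F.filter fun y => ![σ, t] ⬝ᵥ p < ![σ, t] ⬝ᵥ y := Finset.mem_filter.2 ⟨hq, hlt⟩
      have := (Finset.mem_filter.1 (hsub hq')).2
      exact lt_irrefl _ this
  intro p hp q hq hpq
  by_contra hne
  rcases lt_or_gt_of_ne (hgen p hp q hq hne) with hlt | hlt
  · exact absurd hpq (ne_of_gt (key p hp q hq hlt))
  · exact absurd hpq (ne_of_lt (key q hq p hp hlt))

/-- At a generic time the top-`k` set has at most `k` elements. [folklore] -/
theorem card_topSet_le_of_generic {F : Finset (Fin 2 → ℝ)} {t : ℝ} (hgen : Generic σ F t) (k : ℕ) :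
    (topSet σ F k t).card ≤ k := by
  classical
  calc (topSet σ F k t).card ≤ (Finset.range k).card :=
        Finset.card_le_card_of_injOn (rank σ F t) (fun p hp => by
          obtain ⟨-, hlt⟩ := Finset.mem_filter.1 hp
          exact Finset.mem_coe.2 (Finset.mem_range.2 hlt))
          ((rank_injOn_of_generic hgen).mono (by
            intro p hp
            exact Finset.mem_coe.2 (Finset.mem_filter.1 (Finset.mem_coe.1 hp)).1))
    _ = k := Finset.card_range k

/-- A generic time is not the time of a low event. [folklore] -/
theorem lowEvent_fst_ne_of_generic {F : Finset (Fin 2 → ℝ)} {t : ℝ} (hgen : Generic σ F t) {k : ℕ}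
    {e : ℝ × ℝ} (he : IsLowEvent σ F k e) : e.1 ≠ t := by
  intro h
  obtain ⟨p, hp, q, hq, hpq, hpv, hqv⟩ := exists_pair_of_two_le_card_tied he.1
  rw [h] at hpv hqv
  exact hgen p hp q hq hpq (hpv.trans hqv.symm)

/-- The number of low-event times (from a given finite set of times) strictly before `t`: the CELL INDEX of `t`. -/
noncomputable def cellIdx (T : Finset ℝ) (t : ℝ) : ℕ := (T.filter fun u => u < t).card

/-- **Same cell, same top set.**  If all low-event times of order `< k` of `F` belong to `T` and two generic times have the same
cell index, the top-`k` sets agree. [folklore] -/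
theorem topSet_eq_of_cellIdx_eq {F : Finset (Fin 2 → ℝ)} {k : ℕ} {T : Finset ℝ}
    (hT : ∀ e, IsLowEvent σ F k e → e.1 ∈ T) {t t' : ℝ} (ht : Generic σ F t) (ht' : Generic σ F t')
    (hc : cellIdx T t = cellIdx T t') : topSet σ F k t = topSet σ F k t' := by
  classical
  -- the ordered version
  have key : ∀ u u' : ℝ, u ≤ u' → Generic σ F u → Generic σ F u' → cellIdx T u = cellIdx T u' →
      topSet σ F k u = topSet σ F k u' := by
    intro u u' huu hu hu' hcu
    by_contra hne
    obtain ⟨e, he, h1, h2⟩ := exists_lowEvent_of_topSet_ne huu hne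
    have hne1 : e.1 ≠ u := lowEvent_fst_ne_of_generic hu he
    have hne2 : e.1 ≠ u' := lowEvent_fst_ne_of_generic hu' he
    have hlt1 : u < e.1 := lt_of_le_of_ne h1 (Ne.symm hne1)
    have hlt2 : e.1 < u' := lt_of_le_of_ne h2 hne2
    have hsub : T.filter (fun v => v < u) ⊆ T.filter (fun v => v < u') := by
      intro v hv
      obtain ⟨hvT, hvu⟩ := Finset.mem_filter.1 hv
      exact Finset.mem_filter.2 ⟨hvT, hvu.trans_le huu⟩
    have hmem : e.1 ∈ T.filter (fun v => v < u') := Finset.mem_filter.2 ⟨hT e he, hlt2⟩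
    have hnmem : e.1 ∉ T.filter (fun v => v < u) := fun h => by
      have := (Finset.mem_filter.1 h).2
      linarith
    have hlt : cellIdx T u < cellIdx T u' := Finset.card_lt_card ⟨hsub, fun h => hnmem (h hmem)⟩
    omega
  rcases le_total t t' with h | h
  · exact key t t' h ht ht' hc
  · exact (key t' t h ht' ht hc.symm).symm

/-- The SHALLOW PAIRS of depth `< k`: pairs `(x, y) ∈ A × B` that are simultaneously of rank `< k` in their alphabets at some
time generic for both alphabets. -/
noncomputable def shallowPairs (σ : ℝ) (A B : Finset (Fin 2 → ℝ)) (k : ℕ) : Finset ((Fin 2 → ℝ) × (Fin 2 → ℝ)) :=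
  open Classical in
  (A ×ˢ B).filter fun xy => ∃ t : ℝ, Generic σ A t ∧ Generic σ B t ∧ rank σ A t xy.1 < k ∧ rank σ B t xy.2 < k

/-- **Few pairs are ever simultaneously shallow**: `#shallowPairs ≤ k² · (#lowEvents σ A k + #lowEvents σ B k + 1)`.  Generic
times with the same cell index (relative to all low-event times of `A` and `B`) see the same two top-`k` sets, each of size `≤ k`.
[folklore] -/
theorem card_shallowPairs_le (hσ : σ ≠ 0) (A B : Finset (Fin 2 → ℝ)) (k : ℕ) :
    (shallowPairs σ A B k).card ≤ k * k * ((lowEvents σ A k).card + (lowEvents σ B k).card + 1) := by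
  classical
  set LP := shallowPairs σ A B k with hLP
  set T := (lowEvents σ A k).image Prod.fst ∪ (lowEvents σ B k).image Prod.fst with hTdef
  have hTcard : T.card ≤ (lowEvents σ A k).card + (lowEvents σ B k).card :=
    (Finset.card_union_le _ _).trans (add_le_add Finset.card_image_le Finset.card_image_le)
  have hTA : ∀ e, IsLowEvent σ A k e → e.1 ∈ T := fun e he =>
    Finset.mem_union_left _ (Finset.mem_image.2 ⟨e, (mem_lowEvents hσ).2 he, rfl⟩)
  have hTB : ∀ e, IsLowEvent σ B k e → e.1 ∈ T := fun e he =>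
    Finset.mem_union_right _ (Finset.mem_image.2 ⟨e, (mem_lowEvents hσ).2 he, rfl⟩)
  -- witness times
  have hw : ∀ xy ∈ LP, ∃ t : ℝ, Generic σ A t ∧ Generic σ B t ∧ rank σ A t xy.1 < k ∧ rank σ B t xy.2 < k := by
    intro xy hxy
    exact (Finset.mem_filter.1 hxy).2
  choose! w hwA hwB hw1 hw2 using hw
  -- fibres of the cell index
  let f : (Fin 2 → ℝ) × (Fin 2 → ℝ) → ℕ := fun xy => cellIdx T (w xy)
  have hf : ∀ xy ∈ LP, f xy ∈ Finset.range (T.card + 1) := by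
    intro xy _
    rw [Finset.mem_range]
    exact Nat.lt_succ_of_le (Finset.card_filter_le _ _)
  have hfib : ∀ i ∈ Finset.range (T.card + 1), (LP.filter fun xy => f xy = i).card ≤ k * k := by
    intro i _
    rcases (LP.filter fun xy => f xy = i).eq_empty_or_nonempty with h0 | ⟨xy₀, hxy₀⟩
    · rw [h0, Finset.card_empty]; exact Nat.zero_le _
    obtain ⟨hxy₀LP, hf₀⟩ := Finset.mem_filter.1 hxy₀
    set t₀ := w xy₀ with ht₀
    have hsub : (LP.filter fun xy => f xy = i) ⊆ topSet σ A k t₀ ×ˢ topSet σ B k t₀ := by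
      intro xy hxy
      obtain ⟨hxyLP, hfi⟩ := Finset.mem_filter.1 hxy
      have hAB : xy ∈ A ×ˢ B := (Finset.mem_filter.1 hxyLP).1
      obtain ⟨hxA, hyB⟩ := Finset.mem_product.1 hAB
      have hcell : cellIdx T (w xy) = cellIdx T t₀ := by
        change f xy = f xy₀
        rw [hfi, hf₀]
      have hA := topSet_eq_of_cellIdx_eq hTA (hwA xy hxyLP) (hwA xy₀ hxy₀LP) hcell
      have hB := topSet_eq_of_cellIdx_eq hTB (hwB xy hxyLP) (hwB xy₀ hxy₀LP) hcell
      refine Finset.mem_product.2 ⟨?_, ?_⟩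
      · rw [← hA]; exact Finset.mem_filter.2 ⟨hxA, hw1 xy hxyLP⟩
      · rw [← hB]; exact Finset.mem_filter.2 ⟨hyB, hw2 xy hxyLP⟩
    calc (LP.filter fun xy => f xy = i).card ≤ (topSet σ A k t₀ ×ˢ topSet σ B k t₀).card := Finset.card_le_card hsub
      _ = (topSet σ A k t₀).card * (topSet σ B k t₀).card := Finset.card_product _ _
      _ ≤ k * k := Nat.mul_le_mul (card_topSet_le_of_generic (hwA xy₀ hxy₀LP) k)
          (card_topSet_le_of_generic (hwB xy₀ hxy₀LP) k)
  calc LP.card = ∑ i ∈ Finset.range (T.card + 1), (LP.filter fun xy => f xy = i).card :=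
        Finset.card_eq_sum_card_fiberwise hf
    _ ≤ ∑ _i ∈ Finset.range (T.card + 1), k * k := Finset.sum_le_sum hfib
    _ = (T.card + 1) * (k * k) := by rw [Finset.sum_const, Finset.card_range, smul_eq_mul]
    _ ≤ ((lowEvents σ A k).card + (lowEvents σ B k).card + 1) * (k * k) := Nat.mul_le_mul_right _ (by omega)
    _ = k * k * ((lowEvents σ A k).card + (lowEvents σ B k).card + 1) := by ring

/-- **Linear form**: `#shallowPairs ≤ k² · (16k(|A| + |B|) + 1)` for `k ≥ 1` — linear in the alphabet sizes, polynomial in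
the depth.  [folklore: the `(≤ k)`-level bound] -/
theorem card_shallowPairs_le_linear (hσ : σ ≠ 0) (A B : Finset (Fin 2 → ℝ)) {k : ℕ} (hk : 1 ≤ k) :
    (shallowPairs σ A B k).card ≤ k * k * (16 * k * (A.card + B.card) + 1) := by
  calc (shallowPairs σ A B k).card ≤ k * k * ((lowEvents σ A k).card + (lowEvents σ B k).card + 1) :=
        card_shallowPairs_le hσ A B k
    _ ≤ k * k * (16 * A.card * k + 16 * B.card * k + 1) := by
        gcongr
        · exact card_lowEvents_le hσ A hk
        · exact card_lowEvents_le hσ B hk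
    _ = k * k * (16 * k * (A.card + B.card) + 1) := by ring

end TotalsLaw

end Summit.ValiantsHypothesis.ValiantsHypothesis.Theorems.NewtonUnitEquationsDissociatedUniform
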